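import Mathlib
import Summits.Ventures.HodgeRepro.Tier4.Target

/-!
# Tier4/Line3/KMDatum — the archimedean `(1,0)`-datum of LINE L3 (Part I-b of the skeleton, landed) and L3.e

Blind re-derivation cell `pub-hodge-repro`, Tier 4 «PROVE THE STEP» (README §9–§10), LINE L3, seat t4-L3-p1 (prover).
This module lands Part I-b of `Tier4/Line3/Skeleton.lean` (t4-plan-3, v0.6 b7274dfd…, L221–L252) VERBATIM — the
definitions `maj` (the Kudla–Millson majorant), `KMDatum` (the shape of the `(1,0)`-datum) and `datum` — so that the
line's lemma modules (L3.7 `kernel_integral_pos` first) can be stated and landed through the gate, and proves the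
support cut L3.e `datum_smul` (weight `−1` of the datum under the unit scalars).  Skeletons never go through the gate;
the skeleton is meant to `import Summits.Ventures.HodgeRepro.Tier4.Line3.KMDatum` and drop its copies.

Imports: Mathlib and `Tier4/Target.lean` (by name) only.  `#print axioms datum_smul` = `[propext, Classical.choice,
Quot.sound]`.  Nothing here asserts anything about the truth of (P); HC_CM is NOT proved by anyone in this repository.
-/

set_option autoImplicit false

noncomputable section

namespace Summit.Ventures.HodgeRepro.Tier4.Line3

open Summit.Ventures.HodgeRepro.Tier4
open Matrix
open scoped ComplexConjugate

/-! ## Part I-b — the archimedean `(1,0)`-datum on the ball (Kudla–Millson shape; Mathlib-level definitions)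

`maj y z = y^*Jy + 2 |w_z^* J y|² / (1 − |z|²)` (`w_z = lift3 z`) is the minimal positive-definite majorant of `J`
attached to the negative line of `z ∈ 𝔹` (Kudla–Millson IHÉS 71 p. 124; invariant: `maj (M y) (M z) = maj y z` for
`M ∈ U(2,1)`).  A `KMDatum` is the shape of the `(1,0)`-Schwartz form transported to `z`: the `dz_k`-coefficient is an
conjugate-linear form in `y` (`ȳ ⬝ ℓ z k`; Bergeron, Produit, Thm 3.3/3.4 `ψ̄_k = Σ X̄_{i,k} ξ_{i,1}`) of polynomial
growth at `∂𝔹`, times the Gaussian `e^{−π (y,y)_z}`. -/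

/-- The minimal majorant `(y,y)_z` of `J` at `z`. -/
def maj (y : Fin 3 → ℂ) (z : Fin 2 → ℂ) : ℝ :=
  (star y ⬝ᵥ (J *ᵥ y)).re + 2 * ‖star (lift3 z) ⬝ᵥ (J *ᵥ y)‖ ^ 2 / (1 - nsq z)

/-- Archimedean `(1,0)`-data of Kudla–Millson shape on the ball: the `dz_k`-coefficient at `z` is the conjugate-linear
form `ȳ ⬝ ℓ z k` in `y` (Bergeron, Produit, Thm 3.3/3.4: the holomorphic `(q,0)`-classes are the conjugates
`ψ̄_k = Σ X̄_{i,k} ξ_{i,1}`; Liu Lemma D.2(2): the `(1,0)`-representation is `ω(μ_{−1}, −i, 1)`, weight `−1` at `τ₀`),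
continuous in `z` with polynomial growth at `∂𝔹`, times the Gaussian of the majorant. -/
structure KMDatum where
  /-- the coefficient fields of the conjugate-linear form -/
  ℓ : (Fin 2 → ℂ) → Fin 2 → Fin 3 → ℂ
  cont : ∀ k i, ContinuousOn (fun z => ℓ z k i) ball
  /-- polynomial growth at the boundary -/
  growth : ∃ C m : ℝ, ∀ z ∈ ball, ∀ k i, ‖ℓ z k i‖ ≤ C / (1 - nsq z) ^ m

/-- The datum `Φ(y, z)_k = (ȳ ⬝ ℓ z k) · e^{−π (y,y)_z}`. -/
def datum (Φ : KMDatum) (y : Fin 3 → ℂ) (z : Fin 2 → ℂ) (k : Fin 2) : ℂ :=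
  (star y ⬝ᵥ Φ.ℓ z k) * ((Real.exp (-Real.pi * maj y z) : ℝ) : ℂ)

/-- The majorant is invariant under the unit scalars: `maj (t • y) z = maj y z` for `‖t‖ = 1` (both terms are
hermitian-quadratic in `y`). -/
theorem maj_smul (t : ℂ) (ht : ‖t‖ = 1) (y : Fin 3 → ℂ) (z : Fin 2 → ℂ) : maj (t • y) z = maj y z := by
  unfold maj
  have h1 : star (t • y) ⬝ᵥ (J *ᵥ (t • y)) = star y ⬝ᵥ (J *ᵥ y) := by
    rw [star_smul, Matrix.mulVec_smul, smul_dotProduct, dotProduct_smul, smul_eq_mul, smul_eq_mul,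
      ← mul_assoc, Complex.star_def, Complex.conj_mul', ht]
    simp
  have h2 : ‖star (lift3 z) ⬝ᵥ (J *ᵥ (t • y))‖ = ‖star (lift3 z) ⬝ᵥ (J *ᵥ y)‖ := by
    rw [Matrix.mulVec_smul, dotProduct_smul, norm_smul, ht, one_mul]
  rw [h1, h2]

/-- L3.e (support cut): the datum has weight `−1` under the unit scalars, `Φ(t y, z) = conj t · Φ(y, z)` for `|t| = 1`
(the majorant is invariant under unit scalars, the form is conjugate-linear). -/
theorem datum_smul (Φ : KMDatum) (t : ℂ) (ht : ‖t‖ = 1) (y : Fin 3 → ℂ) (z : Fin 2 → ℂ) (k : Fin 2) :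
    datum Φ (t • y) z k = conj t * datum Φ y z k := by
  unfold datum
  rw [maj_smul t ht, star_smul, smul_dotProduct, smul_eq_mul, Complex.star_def, mul_assoc]

end Summit.Ventures.HodgeRepro.Tier4.Line3

end
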